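import Mathlib
import Summits.Ventures.Crystal3D.Theorems.StickyWulffConstantTextureLiminfTexShadowDefs
import Summits.Ventures.Crystal3D.Theorems.StickyWulffConstantTextureLiminfTexShadowVocabulary
import Summits.Ventures.Crystal3D.Theorems.StickyWulffConstantTextureLiminfTexShadowWallDefs
import Summits.Ventures.Crystal3D.Theorems.StickyWulffConstantTextureLiminfTexShadowFluxDefs
import Summits.Ventures.Crystal3D.Theorems.StickyWulffConstantGenericWallFloorRegisteredResidualWide
import HarnessLib

/-!
# TexShadow v6.7 §2/§2b — the two-plate wall law `BilayerWall` and its G/T split, VERBATIM (definitions of record)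
# (lane T, crux `TextureLiminf`, stmt-Ventures-19483; vendored on the planner's instruction, cf-p1 ROUTE.md §86(67) BJ)

HONEST FRAMING. Venture `Summits/Ventures/Crystal3D` (cell `crystal3d-full`), helper `--supports` the crux
`TextureLiminf` (stmt-Ventures-19483) of `route-Ventures-StickyWulffConstant`, registered line `TexShadow`.  Rung credit
only; F-C1 not moved.  DEFINITIONS ONLY (plus two proved glue lemmas); NOT the wall law's proof.

This file is the tree copy of the planner's skeleton HOME/cf-p1/route/lines/tex/TexShadowV67.lean, §2 (`BilayerWall`) and
§2b (`BilayerChargeAdmissible`, `BilayerFramesAt`, `InResidualClass`, `BilayerWallGeneric`, `BilayerWallResidual`,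
`BilayerWallGenericFrom`, `BilayerWallResidualFrom`, `BilayerWallCovered`, `BilayerWallZigzag`, `BilayerWallCoveredFrom`,
`BilayerWallZigzagFrom`, and the proved glues `bilayerWallGeneric_of_tables`, `bilayerWall_of_split`), byte-identical
declarations in the skeleton's namespace (one proof-internal edit: deprecated `push_neg` ↦ `push Not`), so that (i) TexShadow v6.8 imports them instead of declaring them and (ii) the
T-side covered theorem `(hE1 : P5Exhaustion) → ∃ R, 1 ≤ R ∧ BilayerWallCoveredFrom R` (wulff-p2 g14, from
`bilayerWallAt_of_lineCount` + lane G's F4) can live under `Theorems/` and close `stub_bilayerWallCovered` BY NAME.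
`cyl`, `innerBonds`, `BilayerWallAt`, `bilayerWallAt_mono` are the tree's already (`…TexShadowWallDefs`, p639692);
`FluxDominated` is `…TexShadowFluxDefs` (p641847); `InResidualClass` is stated in lane G's residual vocabulary of record
(`…GenericWallFloorRegisteredResidualWide`).
WHAT THIS IS NOT: no proof of any wall law; F-C1 not moved.
-/

noncomputable section

open scoped BigOperators InnerProductSpace ENNReal
open MeasureTheory Filter

namespace Summit.Ventures.Crystal3D.Cruxes.TextureLiminf.TexShadow

open Summit.Ventures.Crystal3D
open Literature.MathematicalPhysics.StatisticalMechanics (fccStacking barlowStacking IsHaggSeq contactDeficiency)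

/-- **TWO-PLATE WALL LAW WITH BILAYER-PAIR CHARGES, for every pair of Barlow stackings, uniform constants**
(v6; replaces v4/v5 `BarlowWall`, whose charge was keyed to the co-axiality of the two STACKINGS).  Cell as
before: clamped bottom plate `P₁ ⊆ S₁` (heights `[-2R₀, -R₀]`), clamped top plate `P₂ ⊆ S₂` (heights
`[h + R₀, h + 2R₀]`), free filling, everything inside the cylinder of radius `ρ`.  The CHARGE is what the slab
texture (§72) pays for a flat cut, averaged over the cut heights `z ∈ [0, 1]`:
`Q = Σ_{i,j} c_ij · |unit slice ∩ laySlab₁ i ∩ laySlab₂ j|` for ANY charge densities `c_ij ≥ 0` DOMINATED BY P's law for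
the normal `e₃` applied to the two BILAYER frames `A₁ i`, `A₂ j` (both fcc): `c_ij ≤ 1` always (the law charges `1` if
they are not co-axial), `c_ij ≤ ½·sin∠(e₃, m_ij)` if they are co-axial with distinct lattices (`m_ij` a shared axis,
unique up to sign), `c_ij = 0` if the lattices are equal [v6.5: directions fixed — v6.0–v6.4 wrote `≥`, a misstatement
found by 19480-p2 g7; the strongest instance is the law table itself].  Claim: `#cross₁ + #cross₂ ≤ D(filling) + ½·innerBonds₁ +
½·innerBonds₂ − Q + C(1+h)ρ` — the filling's deficiency plus the plates' unconsumed inner slots pay the charge.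
Dominated by v5's statement wherever that one made a claim (non-co-axial stackings: `c_ij`-average `≤ 1`;
co-axial: the same `½ sin` on disagreeing bilayers, `0` on agreeing ones) and strictly weaker for non-co-axial
stackings sharing a bilayer orientation (two hcp grains with a common fcc bilayer lattice: v5 charged `1`
everywhere); exactly what P charges the slab texture.  The route cruxes `GenericWallFloor` / `CoaxialWallLaw` are
the instances `σ₁ = σ₂ = fcc` (all bilayer frames equal to the grain frame). -/
def BilayerWall : Prop :=
  ∃ C R₀ : ℝ, 1 ≤ R₀ ∧ ∀ (σ₁ σ₂ : ℤ → ℤ), IsHaggSeq σ₁ → IsHaggSeq σ₂ →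
    ∀ (L₁ L₂ : E3 ≃ₗᵢ[ℝ] E3) (s₁ s₂ : E3) (A₁ A₂ : ℤ → (E3 ≃ₗᵢ[ℝ] E3)),
    (∀ i, ∃ u : E3, bilayer L₁ s₁ σ₁ i ⊆ (fun r => A₁ i r + u) '' fccRef) →
    (∀ j, ∃ u : E3, bilayer L₂ s₂ σ₂ j ⊆ (fun r => A₂ j r + u) '' fccRef) →
    ∀ (c : ℤ → ℤ → ℝ) (m : ℤ → ℤ → E3), (∀ i j, 0 ≤ c i j) →
    (∀ i j, c i j ≤ 1) →
    (∀ i j, CoAx (A₁ i) (A₂ j) → A₁ i '' fccRef ≠ A₂ j '' fccRef →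
      SharedAxis (m i j) (A₁ i) (A₂ j) ∧ c i j ≤ 1 / 2 * Real.sqrt (1 - ⟪m i j, e₃⟫_ℝ ^ 2)) →
    (∀ i j, A₁ i '' fccRef = A₂ j '' fccRef → c i j = 0) →
    ∀ h : ℝ, 0 ≤ h → ∀ ρ : ℝ, R₀ ≤ ρ → ∀ X P₁ P₂ : Finset E3,
      (∀ p ∈ X, ∀ q ∈ X, p ≠ q → 1 ≤ dist p q) → P₁ ⊆ X → P₂ ⊆ X \ P₁ → (∀ p ∈ X, p ∈ cyl R₀ h ρ) →
      (∀ p, p ∈ P₁ ↔ (p ∈ stacking L₁ s₁ σ₁ ∧ -(2 * R₀) ≤ p 2 ∧ p 2 ≤ -R₀ ∧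
        p 0 ^ 2 + p 1 ^ 2 ≤ ρ ^ 2)) →
      (∀ p, p ∈ P₂ ↔ (p ∈ stacking L₂ s₂ σ₂ ∧ h + R₀ ≤ p 2 ∧ p 2 ≤ h + 2 * R₀ ∧
        p 0 ^ 2 + p 1 ^ 2 ≤ ρ ^ 2)) →
      ((((P₁ ×ˢ (X \ P₁)).filter fun pq => dist pq.1 pq.2 = 1).card : ℕ) : ℝ) +
        ((((P₂ ×ˢ ((X \ P₁) \ P₂)).filter fun pq => dist pq.1 pq.2 = 1).card : ℕ) : ℝ) ≤
        contactDeficiency ((X \ P₁) \ P₂) +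
          1 / 2 * innerBonds (stacking L₁ s₁ σ₁) P₁ (fun q => -R₀ < q 2) +
          1 / 2 * innerBonds (stacking L₂ s₂ σ₂) P₂ (fun q => q 2 < h + R₀) -
          (∑' ij : ℤ × ℤ, c ij.1 ij.2 *
            (volume ({q : E3 | 0 ≤ q 2 ∧ q 2 ≤ 1 ∧ q 0 ^ 2 + q 1 ^ 2 ≤ ρ ^ 2} ∩
              laySlab L₁ s₁ ij.1 ∩ laySlab L₂ s₂ ij.2)).toReal) +
          C * (1 + h) * ρ

/-! ## §2b (v6.4) The wall cell inequality with explicit constants, and the G/T split of the wall law -/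

open Summit.Ventures.Crystal3D.Theorems in
/-- The pair charges `c i j ≥ 0` (with shared axes `m i j`) are ADMISSIBLE for the bilayer frames `A₁ i`, `A₂ j`, i.e.
DOMINATED BY P's law for the normal `e₃` (v6.5 fix, 19480-p2 g7: the charge enters the cell inequality with a MINUS sign,
so the wall law must be claimed for tables BELOW the law — `≤ 1` always, `≤ ½ sin∠(e₃, m)` if co-axial with distinct
lattices, `= 0` for equal lattices; v6.0–v6.4 had the two bounds the wrong way round (`1 ≤ c`, `½ sin ≤ c`), which is
false in two lines: empty filling, far plates, `c ≡ K → ∞`).  The four hypotheses of `BilayerWall`, conjoined. -/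
def BilayerChargeAdmissible (A₁ A₂ : ℤ → (E3 ≃ₗᵢ[ℝ] E3)) (c : ℤ → ℤ → ℝ) (m : ℤ → ℤ → E3) : Prop :=
  (∀ i j, 0 ≤ c i j) ∧ (∀ i j, c i j ≤ 1) ∧
    (∀ i j, CoAx (A₁ i) (A₂ j) → A₁ i '' fccRef ≠ A₂ j '' fccRef →
      SharedAxis (m i j) (A₁ i) (A₂ j) ∧ c i j ≤ 1 / 2 * Real.sqrt (1 - ⟪m i j, e₃⟫_ℝ ^ 2)) ∧
    (∀ i j, A₁ i '' fccRef = A₂ j '' fccRef → c i j = 0)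

/-- The bilayer frames `A i` WITH ORIGINS `u i` of the Barlow stacking `(L, s, σ)`: bilayer `i` lies on the moved fcc
lattice `A i · fccRef + u i` (the per-top frame of a plate ball `t ∈ bilayer L s σ i` is `A i`; when the layers are
inclined to the cut the frames alternate strip by strip). -/
def BilayerFramesAt (L : E3 ≃ₗᵢ[ℝ] E3) (s : E3) (σ : ℤ → ℤ) (A : ℤ → (E3 ≃ₗᵢ[ℝ] E3)) (u : ℤ → E3) : Prop :=
  ∀ i, bilayer L s σ i ⊆ (fun r => A i r + u i) '' fccRef

open Summit.Ventures.Crystal3D.Theorems in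
/-- A facing pair of bilayer frames (with origins `t₁, t₂`) falls in lane G's RESIDUAL CLASS of record: EXACTLY the
hypothesis list of the tree's `GenericWallFloorRegisteredResidualWide` (non-co-axial as «no common Barlow stacking»,
`RayAlignedAt`, none of the six Σ9 cells, not `SeparatedWideAt`, `RegisteredAt`). -/
def InResidualClass (A₁ A₂ : E3 ≃ₗᵢ[ℝ] E3) (t₁ t₂ : E3) : Prop :=
  ¬ (∃ (L : E3 ≃ₗᵢ[ℝ] E3) (r₁ r₂ : E3) (σ σ' : ℤ → ℤ), IsHaggSeq σ ∧ IsHaggSeq σ' ∧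
      (fun p => A₁ p + t₁) '' fccStacking 1 (Real.sqrt (2 / 3)) ⊆
        (fun p => L p + r₁) '' barlowStacking 1 (Real.sqrt (2 / 3)) σ ∧
      (fun p => A₂ p + t₂) '' fccStacking 1 (Real.sqrt (2 / 3)) ⊆
        (fun p => L p + r₂) '' barlowStacking 1 (Real.sqrt (2 / 3)) σ') ∧
    RayAlignedAt A₁ A₂ ∧ ¬ Sigma9OneSidedAt A₁ A₂ ∧ ¬ Sigma9OneSidedDownAt A₁ A₂ ∧ ¬ Sigma9TiltAt A₁ A₂ ∧
    ¬ Sigma9TiltDownAt A₁ A₂ ∧ ¬ Sigma9WideAt A₁ A₂ ∧ ¬ Sigma9WideDownAt A₁ A₂ ∧ ¬ SeparatedWideAt A₁ A₂ ∧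
    RegisteredAt A₁ t₁ A₂ t₂

/-- **GENERIC PART of the wall law at constants `(C, R₀)`** — the cell inequality for every pair of Barlow plates NONE of
whose facing bilayer-frame pairs is in the residual class: the target of lane G's walker ledger with per-top frames
(CAP-START + `…offReach` + the Σ9/wide/separated cells, strip by strip) plus the Barlow sample-deficit bridge to T's currency. -/
def BilayerWallGeneric (C R₀ : ℝ) : Prop :=
  ∀ (σ₁ σ₂ : ℤ → ℤ), IsHaggSeq σ₁ → IsHaggSeq σ₂ →
    ∀ (L₁ L₂ : E3 ≃ₗᵢ[ℝ] E3) (s₁ s₂ : E3) (A₁ A₂ : ℤ → (E3 ≃ₗᵢ[ℝ] E3)) (u₁ u₂ : ℤ → E3),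
    BilayerFramesAt L₁ s₁ σ₁ A₁ u₁ → BilayerFramesAt L₂ s₂ σ₂ A₂ u₂ →
    (∀ i j : ℤ, ¬ InResidualClass (A₁ i) (A₂ j) (u₁ i) (u₂ j)) →
    ∀ (c : ℤ → ℤ → ℝ) (m : ℤ → ℤ → E3), BilayerChargeAdmissible A₁ A₂ c m →
      BilayerWallAt C R₀ σ₁ σ₂ L₁ L₂ s₁ s₂ c

/-- **RESIDUAL PART of the wall law at constants `(C, R₀)`** — the cell inequality for the pairs of Barlow plates SOME
facing bilayer-frame pair of which is in lane G's residual class: ONE residual family for lanes G and T (G's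
`GenericWallFloorRegisteredResidualWide` is the instance σ₁ = σ₂ = fcc, all frames equal, up to currency). -/
def BilayerWallResidual (C R₀ : ℝ) : Prop :=
  ∀ (σ₁ σ₂ : ℤ → ℤ), IsHaggSeq σ₁ → IsHaggSeq σ₂ →
    ∀ (L₁ L₂ : E3 ≃ₗᵢ[ℝ] E3) (s₁ s₂ : E3) (A₁ A₂ : ℤ → (E3 ≃ₗᵢ[ℝ] E3)) (u₁ u₂ : ℤ → E3),
    BilayerFramesAt L₁ s₁ σ₁ A₁ u₁ → BilayerFramesAt L₂ s₂ σ₂ A₂ u₂ →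
    (∃ i j : ℤ, InResidualClass (A₁ i) (A₂ j) (u₁ i) (u₂ j)) →
    ∀ (c : ℤ → ℤ → ℝ) (m : ℤ → ℤ → E3), BilayerChargeAdmissible A₁ A₂ c m →
      BilayerWallAt C R₀ σ₁ σ₂ L₁ L₂ s₁ s₂ c

/-- The generic part holds FROM plate thickness `R` on: every `R₀ ≥ R` admits a rim constant. -/
def BilayerWallGenericFrom (R : ℝ) : Prop := ∀ R₀ : ℝ, R ≤ R₀ → ∃ C : ℝ, BilayerWallGeneric C R₀

/-- The residual part holds FROM plate thickness `R` on. -/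
def BilayerWallResidualFrom (R : ℝ) : Prop := ∀ R₀ : ℝ, R ≤ R₀ → ∃ C : ℝ, BilayerWallResidual C R₀

/-! ### v6.7: the generic part split BY TABLE on the zigzag flux (`FluxDominated`, tree `…TexShadowFluxDefs`) -/

/-- **WALKER-COVERED PART of the generic wall law at `(C, R₀)`** (v6.7): the cell inequality for generic (non-residual)
plate pairs and the admissible charge tables that are FLUX-DOMINATED at steepness `√2/2` — strip by strip
`c i j ≤ ½ (plateFlux₁ i + plateFlux₂ j)`, i.e. the table is paid by the two plates' zigzag walker starts. -/
def BilayerWallCovered (C R₀ : ℝ) : Prop :=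
  ∀ (σ₁ σ₂ : ℤ → ℤ), IsHaggSeq σ₁ → IsHaggSeq σ₂ →
    ∀ (L₁ L₂ : E3 ≃ₗᵢ[ℝ] E3) (s₁ s₂ : E3) (A₁ A₂ : ℤ → (E3 ≃ₗᵢ[ℝ] E3)) (u₁ u₂ : ℤ → E3),
    BilayerFramesAt L₁ s₁ σ₁ A₁ u₁ → BilayerFramesAt L₂ s₂ σ₂ A₂ u₂ →
    (∀ i j : ℤ, ¬ InResidualClass (A₁ i) (A₂ j) (u₁ i) (u₂ j)) →
    ∀ (c : ℤ → ℤ → ℝ) (m : ℤ → ℤ → E3), BilayerChargeAdmissible A₁ A₂ c m →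
      FluxDominated (Real.sqrt 2 / 2) L₁ σ₁ L₂ σ₂ c →
      BilayerWallAt C R₀ σ₁ σ₂ L₁ L₂ s₁ s₂ c

/-- **ZIGZAG-DEFICIT PART of the generic wall law at `(C, R₀)`** (v6.7): the same cell inequality for the admissible
tables that are NOT flux-dominated (some strip pair charges more than half the two walker fluxes: h-layer-rich plates at
unfavourable orientations).  No walker certificate covers these; the statement is the law's claim on them. -/
def BilayerWallZigzag (C R₀ : ℝ) : Prop :=
  ∀ (σ₁ σ₂ : ℤ → ℤ), IsHaggSeq σ₁ → IsHaggSeq σ₂ →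
    ∀ (L₁ L₂ : E3 ≃ₗᵢ[ℝ] E3) (s₁ s₂ : E3) (A₁ A₂ : ℤ → (E3 ≃ₗᵢ[ℝ] E3)) (u₁ u₂ : ℤ → E3),
    BilayerFramesAt L₁ s₁ σ₁ A₁ u₁ → BilayerFramesAt L₂ s₂ σ₂ A₂ u₂ →
    (∀ i j : ℤ, ¬ InResidualClass (A₁ i) (A₂ j) (u₁ i) (u₂ j)) →
    ∀ (c : ℤ → ℤ → ℝ) (m : ℤ → ℤ → E3), BilayerChargeAdmissible A₁ A₂ c m →
      ¬ FluxDominated (Real.sqrt 2 / 2) L₁ σ₁ L₂ σ₂ c →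
      BilayerWallAt C R₀ σ₁ σ₂ L₁ L₂ s₁ s₂ c

/-- The covered part holds FROM plate thickness `R` on. -/
def BilayerWallCoveredFrom (R : ℝ) : Prop := ∀ R₀ : ℝ, R ≤ R₀ → ∃ C : ℝ, BilayerWallCovered C R₀

/-- The zigzag part holds FROM plate thickness `R` on. -/
def BilayerWallZigzagFrom (R : ℝ) : Prop := ∀ R₀ : ℝ, R ≤ R₀ → ∃ C : ℝ, BilayerWallZigzag C R₀

/-- **Glue (real proof, v6.7): covered part + zigzag part ⇒ generic part** — larger threshold, larger rim constant,
`by_cases` on `FluxDominated`. -/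
theorem bilayerWallGeneric_of_tables {R_C R_Z : ℝ} (hC1 : 1 ≤ R_C) (hC : BilayerWallCoveredFrom R_C)
    (hZ : BilayerWallZigzagFrom R_Z) : BilayerWallGenericFrom (max R_C R_Z) := by
  classical
  intro R₀ hR₀
  have hR₀C : R_C ≤ R₀ := le_trans (le_max_left _ _) hR₀
  have hR₀Z : R_Z ≤ R₀ := le_trans (le_max_right _ _) hR₀
  have hR₀0 : 0 ≤ R₀ := by linarith
  obtain ⟨C₁, hC₁⟩ := hC R₀ hR₀C
  obtain ⟨C₂, hC₂⟩ := hZ R₀ hR₀Z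
  refine ⟨max C₁ C₂, ?_⟩
  intro σ₁ σ₂ hσ₁ hσ₂ L₁ L₂ s₁ s₂ A₁ A₂ u₁ u₂ hu₁ hu₂ hgen c m hadm
  by_cases hflux : FluxDominated (Real.sqrt 2 / 2) L₁ σ₁ L₂ σ₂ c
  · exact bilayerWallAt_mono hR₀0 (le_max_left _ _)
      (hC₁ σ₁ σ₂ hσ₁ hσ₂ L₁ L₂ s₁ s₂ A₁ A₂ u₁ u₂ hu₁ hu₂ hgen c m hadm hflux)
  · exact bilayerWallAt_mono hR₀0 (le_max_right _ _)
      (hC₂ σ₁ σ₂ hσ₁ hσ₂ L₁ L₂ s₁ s₂ A₁ A₂ u₁ u₂ hu₁ hu₂ hgen c m hadm hflux)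

/-- **Glue (real proof): generic part + residual part ⇒ the wall law `BilayerWall`** — take the larger threshold, the
larger rim constant (monotonicity in `C`), and split on whether some facing pair is in the residual class. -/
theorem bilayerWall_of_split {R_G R_R : ℝ} (hG1 : 1 ≤ R_G) (hG : BilayerWallGenericFrom R_G)
    (hR : BilayerWallResidualFrom R_R) : BilayerWall := by
  classical
  set R₀ : ℝ := max R_G R_R with hR₀def
  have hR₀G : R_G ≤ R₀ := le_max_left _ _
  have hR₀R : R_R ≤ R₀ := le_max_right _ _
  have hR₀1 : 1 ≤ R₀ := le_trans hG1 hR₀G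
  obtain ⟨C₁, hC₁⟩ := hG R₀ hR₀G
  obtain ⟨C₂, hC₂⟩ := hR R₀ hR₀R
  refine ⟨max C₁ C₂, R₀, hR₀1, ?_⟩
  intro σ₁ σ₂ hσ₁ hσ₂ L₁ L₂ s₁ s₂ A₁ A₂ hA₁ hA₂ c m hc0 hc1 hc2 hc3
  choose u₁ hu₁ using hA₁
  choose u₂ hu₂ using hA₂
  have hadm : BilayerChargeAdmissible A₁ A₂ c m := ⟨hc0, hc1, hc2, hc3⟩
  by_cases hres : ∃ i j : ℤ, InResidualClass (A₁ i) (A₂ j) (u₁ i) (u₂ j)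
  · exact bilayerWallAt_mono (by linarith) (le_max_right _ _)
      (hC₂ σ₁ σ₂ hσ₁ hσ₂ L₁ L₂ s₁ s₂ A₁ A₂ u₁ u₂ hu₁ hu₂ hres c m hadm)
  · push Not at hres
    exact bilayerWallAt_mono (by linarith) (le_max_left _ _)
      (hC₁ σ₁ σ₂ hσ₁ hσ₂ L₁ L₂ s₁ s₂ A₁ A₂ u₁ u₂ hu₁ hu₂ (fun i j => hres i j) c m hadm)

end Summit.Ventures.Crystal3D.Cruxes.TextureLiminf.TexShadow

end
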